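import Summits.Ventures.HodgeKum4.Theorems.KummerFixedLocusHilbertKummerTransferFibre
import Literature.Algebra.Lie.LefschetzModuleTensorFactor
import Literature.Algebra.Lie.LefschetzModuleTensor
import Mathlib.RingTheory.Flat.Basic
import HarnessLib

/-!
# V0 (`HilbertKummerTransfer`) — the fibre range as an `𝔰𝔩₂`-module and `H*(H) ≅ H*(A) ⊗ R` as `(L, h)`-modules
# (cell `hodge-kum4`, lane (V), seat p2; part 1 of the Lefschetz transport)

Route `KummerFixedLocus`, item `HilbertKummerTransfer` (stmt-Ventures-20354).  HONEST FRAMING: helper theorems;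
nothing about V0, L1 or the Hodge conjecture is proved in this file.

Setting: `Θ = kummerCover act j : A × K ⟶ H` with a finite Galois cover structure on complex points (the F6 fact
`HilbertScheme.Beauville1983_kummerCover_galois` as DATA), `K` smooth projective of dimension `2n` (`n ≥ 1`),
`ℓ ∈ H²(H(ℂ))` with dual Lefschetz operators `Λ_H` on `H` (dimension `2(n+1)`) and `Λ_K` of `θ^* ℓ` on `K`
(dimension `2n`), and `Θ^* ℓ = fst^* x + snd^* θ^* ℓ` (`…Fibre.exists_map_kummerCover_two_eq`).  `R = fibreRange`
(`= im θ^*`), `κ = kunnethEquiv`.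

* §1 generic: `𝔰𝔩₂`-triples transport along linear equivalences (`isSl2Triple_conj`) and restrict to stable
  subspaces (`IsSl2Triple.restrict`).
* §2 `R ⊆ H*(K)` is an `𝔰𝔩₂`-submodule: the restrictions `fibreDegreeOp = h_K|_R`, `fibreLefschetzOp = L_{θ^*ℓ}|_R`
  and `Λ_K|_R` form an `𝔰𝔩₂`-triple (`isSl2Triple_fibreRange`), `(R, h_K|_R)` is `ℤ`-graded
  (`isZGrading_fibreRange`), so `L_{θ^*ℓ}|_R` has the Lefschetz property.
* §3 **`H*(H) ≅ H*(A) ⊗ R` as `(L, h)`-modules**: `psi : H*(A) ⊗ R ≃ H*(H)` with `Θ^* ∘ Ψ = κ ∘ (id ⊗ incl)`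
  (`totalPullback_psi`), intertwining `tensorDegreeOp = h_A ⊗ 1 + 1 ⊗ h_R` with `h_H` and
  `tensorLefschetzOp x = L_x ⊗ 1 + 1 ⊗ L_R` with `L_ℓ`; hence `tensorLefschetzOp x` has the Lefschetz property
  (`hasLefschetzProperty_tensor_fibreRange`).
* (§4, the sequel `…TransferLefschetz.lean`: `x` is Lefschetz on `A` and `Θ^* ∘ Λ_H = Λ_{A × K} ∘ Θ^*`.)
-/

noncomputable section

open CategoryTheory MonoidalCategory CartesianMonoidalCategory DirectSum TensorProduct
open Literature.AlgebraicTopology.SingularHomology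
open Literature.AlgebraicGeometry Literature.AlgebraicGeometry.Motives Literature.AlgebraicGeometry.Hyperkaehler
open Literature.AlgebraicGeometry.HilbertScheme Literature.AlgebraicGeometry.HodgeTheory
open Literature.Algebra.Lie (degreeSpace IsZGrading HasLefschetzProperty)

-- The commutator Lie ring on `Module.End`, enabled file-locally exactly as in `Literature/Algebra/Lie/*` (needed to
-- STATE `IsSl2Triple` for restricted and tensor operators).
attribute [local instance 100] LieRing.ofAssociativeRing

namespace Summit.Ventures.HodgeKum4.HilbertKummer

open scoped MonObj

/-! ### §1 Generic: transport and restriction of `𝔰𝔩₂`-triples -/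

section Generic

variable {K₀ : Type*} [Field K₀] {V V' : Type*} [AddCommGroup V] [Module K₀ V] [AddCommGroup V'] [Module K₀ V']

/-- **`𝔰𝔩₂`-triples transport along linear equivalences**: `(σ h σ⁻¹, σ e σ⁻¹, σ f σ⁻¹)` is an `𝔰𝔩₂`-triple on `V'`
if `(h, e, f)` is one on `V` (`σ : V ≃ V'`). -/
theorem isSl2Triple_conj (σ : V ≃ₗ[K₀] V') {h e f : Module.End K₀ V} (t : IsSl2Triple h e f) :
    IsSl2Triple (σ.conj h) (σ.conj e) (σ.conj f) := by
  have hbr : ∀ a b : Module.End K₀ V, ⁅σ.conj a, σ.conj b⁆ = σ.conj ⁅a, b⁆ := fun a b ↦ by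
    rw [Ring.lie_def, Ring.lie_def, map_sub, Module.End.mul_eq_comp, Module.End.mul_eq_comp, ← LinearEquiv.conj_comp,
      ← LinearEquiv.conj_comp]
    rfl
  refine ⟨fun h0 ↦ t.h_ne_zero ?_, ?_, ?_, ?_⟩
  · have := congrArg σ.symm.conj h0
    rwa [LinearEquiv.conj_symm_conj, map_zero] at this
  · rw [hbr, t.lie_e_f]
  · rw [hbr, t.lie_h_e_nsmul, map_nsmul]
  · rw [hbr, t.lie_h_f_nsmul, map_neg, map_nsmul]

/-- Bracket identities restrict to stable subspaces: `⁅a, b⁆ = k • c` on `V` gives the same on `W`. -/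
theorem lie_restrict_eq {a b c : Module.End K₀ V} {W : Submodule K₀ V} (ha : ∀ w ∈ W, a w ∈ W)
    (hb : ∀ w ∈ W, b w ∈ W) (hc : ∀ w ∈ W, c w ∈ W) (k : ℤ) (habc : ⁅a, b⁆ = k • c) :
    ⁅a.restrict ha, b.restrict hb⁆ = k • c.restrict hc := by
  refine LinearMap.ext fun w ↦ Subtype.ext ?_
  have h1 := LinearMap.congr_fun habc (w : V)
  simp only [Ring.lie_def, LinearMap.sub_apply, Module.End.mul_apply, LinearMap.smul_apply] at h1 ⊢
  rw [Submodule.coe_sub, Submodule.coe_smul_of_tower, LinearMap.coe_restrict_apply, LinearMap.coe_restrict_apply,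
    LinearMap.coe_restrict_apply, LinearMap.coe_restrict_apply, LinearMap.coe_restrict_apply]
  exact h1

/-- **`𝔰𝔩₂`-triples restrict to stable subspaces** on which `h` does not vanish. -/
theorem IsSl2Triple.restrict {h e f : Module.End K₀ V} (t : IsSl2Triple h e f) {W : Submodule K₀ V}
    (hh : ∀ w ∈ W, h w ∈ W) (he : ∀ w ∈ W, e w ∈ W) (hf : ∀ w ∈ W, f w ∈ W) (h0 : h.restrict hh ≠ 0) :
    IsSl2Triple (h.restrict hh) (e.restrict he) (f.restrict hf) := by
  refine ⟨h0, ?_, ?_, ?_⟩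
  · have := lie_restrict_eq he hf hh 1 (by rw [one_smul]; exact t.lie_e_f)
    rwa [one_smul] at this
  · have := lie_restrict_eq hh he he 2 (by rw [t.lie_h_e_nsmul]; norm_cast)
    rw [this]; norm_cast
  · have := lie_restrict_eq hh hf hf (-2) (by rw [t.lie_h_f_nsmul, neg_smul]; norm_cast)
    rw [this, neg_smul]; norm_cast

/-- A restricted operator has the same eigenvalue condition: `w ∈ (W, h|_W)_m ↔ (w : V) ∈ V_m`. -/
theorem mem_degreeSpace_restrict_iff {h : Module.End K₀ V} {W : Submodule K₀ V} (hh : ∀ w ∈ W, h w ∈ W) (m : ℤ)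
    (w : W) : w ∈ degreeSpace (h.restrict hh) m ↔ (w : V) ∈ degreeSpace h m := by
  rw [Literature.Algebra.Lie.mem_degreeSpace_iff, Literature.Algebra.Lie.mem_degreeSpace_iff, ← Subtype.coe_inj,
    LinearMap.coe_restrict_apply, Submodule.coe_smul_of_tower]

end Generic

/-- `1 ≠ 0` in `H⁰(X(ℂ); ℂ)` for `X` smooth projective (`b₀ = 1`). -/
theorem one_ne_zero_of_isSmoothProjective {X : SchemeOver ℂ} {m : ℕ} (hX : IsSmoothProjective m X) :
    singularCohomology.one ℂ (ComplexPoints X) ≠ 0 := by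
  intro h0
  have hall : ∀ b : complexBetti X 0, b = 0 := fun b ↦ by
    obtain ⟨d, hd⟩ := exists_eq_smul_one_of_isSmoothProjective hX ℂ b; rw [hd, h0, smul_zero]
  haveI : Subsingleton (complexBetti X 0) := ⟨fun a b ↦ by rw [hall a, hall b]⟩
  have := Literature.AlgebraicGeometry.Surfaces.finrank_complexBetti_zero hX
  rw [Module.finrank_zero_of_subsingleton] at this
  exact zero_ne_one this

/-- `h_N ≠ 0` on `H*(X(ℂ))` for `X` smooth projective and `N ≠ 0` (it is `-N` on `H⁰ ∋ 1 ≠ 0`). -/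
theorem degreeOperator_ne_zero_of_isSmoothProjective {X : SchemeOver ℂ} {m : ℕ} (hX : IsSmoothProjective m X)
    {N : ℕ} (hN : N ≠ 0) : degreeOperator ℂ (ComplexPoints X) N ≠ 0 :=
  degreeOperator_ne_zero_of_ne_zero (k := 0) (N := N) (by omega) (one_ne_zero_of_isSmoothProjective hX)

/-! ### §2 The fibre range as an `𝔰𝔩₂`-submodule of `H*(K)` -/

section Main

variable {A : AbelianVariety ℂ} {K H : SchemeOver ℂ} {n k : ℕ} {Ξ : (A.X ⊗ H).left.IdealSheafData}
  {act : A.X ⊗ H ⟶ H} {j : K ⟶ H}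
  {G : Type} [Group G] [Fintype G] [MulAction G (ComplexPoints (A.X ⊗ K))]
  (c : FiniteDeckCover G (ComplexPoints (A.X ⊗ K)) (ComplexPoints H))
  (hc : c.proj = AlgPoints.mapContinuous (L := ℂ) (kummerCover act j))
  (hdeck : ∀ g : G, ∃ (b : 𝟙_ (SchemeOver ℂ) ⟶ A.X) (τ : K ⟶ K),
    c.deck g = AlgPoints.mapContinuous (L := ℂ) (A.translate b⁻¹ ⊗ₘ τ))
  (hS : IsSmoothProjective 2 A.X) (hK : IsSmoothProjective (2 * n) K) (hH : IsHilbertSchemeOfPoints k A.X H Ξ)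
  (hact : IsTranslationAction Ξ act)

include hc hdeck hS hK hH hact in
/-- `R` is stable under the Lefschetz operator of `θ^* ℓ` (cup-closed and `θ^* ℓ ∈ R`). -/
theorem totalLefschetz_mem_fibreRange (ℓ : complexBetti H 2) {s : totalCohomology ℂ (ComplexPoints K)}
    (hs : s ∈ fibreRange A K (kummerCover act j)) :
    totalLefschetz (complexBetti.map j 2 ℓ) s ∈ fibreRange A K (kummerCover act j) := by
  rw [totalLefschetz_eq_totalCup]
  refine isCupClosed_fibreRange c hc hdeck hS hK hH hact _ ?_ _ hs
  have h1 := totalPullback_mem_fibreRange c hc hdeck hS hK hH hact (ofDegree ℂ (ComplexPoints H) 2 ℓ)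
  rwa [totalPullback_lof] at h1

/-- **`h_R = h_K|_R`**, the degree operator restricted to the fibre range. -/
def fibreDegreeOp : Module.End ℂ (fibreRange A K (kummerCover act j)) :=
  (degreeOperator ℂ (ComplexPoints K) (2 * n)).restrict
    (fun _ hs ↦ degreeOperator_mem_fibreRange c hc hdeck hS hK hH hact (2 * n) hs)

/-- **`L_R = L_{θ^*ℓ}|_R`**, the Lefschetz operator of `θ^* ℓ` restricted to the fibre range. -/
def fibreLefschetzOp (ℓ : complexBetti H 2) : Module.End ℂ (fibreRange A K (kummerCover act j)) :=
  (totalLefschetz (complexBetti.map j 2 ℓ)).restrict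
    (fun _ hs ↦ totalLefschetz_mem_fibreRange c hc hdeck hS hK hH hact ℓ hs)

/-- `h_R` on underlying vectors. -/
@[simp]
theorem coe_fibreDegreeOp (s : fibreRange A K (kummerCover act j)) :
    (fibreDegreeOp c hc hdeck hS hK hH hact s : totalCohomology ℂ (ComplexPoints K)) =
      degreeOperator ℂ (ComplexPoints K) (2 * n) s :=
  rfl

/-- `L_R` on underlying vectors. -/
@[simp]
theorem coe_fibreLefschetzOp (ℓ : complexBetti H 2) (s : fibreRange A K (kummerCover act j)) :
    (fibreLefschetzOp c hc hdeck hS hK hH hact ℓ s : totalCohomology ℂ (ComplexPoints K)) =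
      totalLefschetz (complexBetti.map j 2 ℓ) s :=
  rfl

include hc hdeck hS hK hH hact in
/-- **`(R, h_R)` is `ℤ`-graded**: every `θ^* w` is the sum of the `θ^*` of the homogeneous components of `w`. -/
theorem isZGrading_fibreRange : IsZGrading (fibreDegreeOp c hc hdeck hS hK hH hact) := by
  classical
  rw [IsZGrading, eq_top_iff]
  rintro ⟨s, hs⟩ -
  have hs' := hs
  rw [fibreRange_eq_range c hc hdeck hS hK hH hact] at hs'
  obtain ⟨w, hws⟩ := hs'
  have hmem : ∀ i, totalPullback ℂ (AlgPoints.mapContinuous (L := ℂ) j) (ofDegree ℂ (ComplexPoints H) i (w i)) ∈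
      fibreRange A K (kummerCover act j) := fun i ↦
    totalPullback_mem_fibreRange c hc hdeck hS hK hH hact _
  have heq : (⟨s, hs⟩ : fibreRange A K (kummerCover act j)) = ∑ i ∈ w.support, ⟨_, hmem i⟩ := by
    apply Subtype.ext
    rw [Submodule.coe_sum]
    change s = ∑ i ∈ w.support, totalPullback ℂ (AlgPoints.mapContinuous (L := ℂ) j) (ofDegree ℂ (ComplexPoints H) i (w i))
    rw [← map_sum, ← hws]
    congr 1
    exact (DirectSum.sum_support_of w).symm
  rw [heq]
  refine Submodule.sum_mem _ fun i _ ↦ Submodule.mem_iSup_of_mem ((i : ℤ) - (2 * n : ℕ)) ?_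
  rw [fibreDegreeOp, mem_degreeSpace_restrict_iff]
  change totalPullback ℂ _ (ofDegree ℂ (ComplexPoints H) i (w i)) ∈ _
  rw [totalPullback_lof]
  exact ofDegree_mem_degreeSpace (2 * n) i rfl _

include hc hdeck hS hK hH hact in
/-- **`(h_R, L_R, Λ_K|_R)` is an `𝔰𝔩₂`-triple on `R`** (`n ≥ 1`, so that `h_R (1) ≠ 0`). -/
theorem isSl2Triple_fibreRange (hn : 1 ≤ n) (ℓ : complexBetti H 2)
    {Λ : Module.End ℂ (totalCohomology ℂ (ComplexPoints K))} (hΛ : IsDualLefschetz (2 * n) (complexBetti.map j 2 ℓ) Λ) :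
    IsSl2Triple (fibreDegreeOp c hc hdeck hS hK hH hact) (fibreLefschetzOp c hc hdeck hS hK hH hact ℓ)
      (Λ.restrict (fun _ hs ↦ lambda_mem_fibreRange c hc hdeck hS hK hH hact ℓ hΛ hs)) := by
  refine IsSl2Triple.restrict hΛ _ _ _ fun h0 ↦ ?_
  have h1 := LinearMap.congr_fun h0 ⟨_, one_mem_fibreRange (A := A) (K := K) (kummerCover act j)⟩
  have h2 := congrArg Subtype.val h1
  rw [LinearMap.coe_restrict_apply] at h2
  exact degreeOperator_one_ne_zero hK hn h2

include hc hdeck hS hK hH hact in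
/-- Hence `L_R` has the Lefschetz property on `(R, h_R)`. -/
theorem hasLefschetzProperty_fibreRange (hn : 1 ≤ n) (ℓ : complexBetti H 2)
    {Λ : Module.End ℂ (totalCohomology ℂ (ComplexPoints K))} (hΛ : IsDualLefschetz (2 * n) (complexBetti.map j 2 ℓ) Λ) :
    HasLefschetzProperty (fibreDegreeOp c hc hdeck hS hK hH hact) (fibreLefschetzOp c hc hdeck hS hK hH hact ℓ) :=
  haveI := finite_totalCohomology hK
  Literature.Algebra.Lie.hasLefschetzProperty_of_isSl2Triple (isZGrading_fibreRange c hc hdeck hS hK hH hact)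
    (isSl2Triple_fibreRange c hc hdeck hS hK hH hact hn ℓ hΛ)

/-! ### §3 `H*(H) ≅ H*(A) ⊗ R` as `(L, h)`-modules -/

/-- `Φ = κ ∘ (id ⊗ incl_R) : H*(A) ⊗ R → H*((A × K)(ℂ))`. -/
def phi : totalCohomology ℂ (ComplexPoints A.X) ⊗[ℂ] (fibreRange A K (kummerCover act j)) →ₗ[ℂ]
    totalCohomology ℂ (ComplexPoints (A.X ⊗ K)) :=
  kunnethCross A.X K ∘ₗ (fibreRange A K (kummerCover act j)).subtype.lTensor (totalCohomology ℂ (ComplexPoints A.X))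

/-- `Φ (a ⊗ s) = a × s`. -/
@[simp]
theorem phi_tmul (a : totalCohomology ℂ (ComplexPoints A.X)) (s : fibreRange A K (kummerCover act j)) :
    phi (j := j) (act := act) (a ⊗ₜ s) = kunnethCross A.X K (a ⊗ₜ (s : totalCohomology ℂ (ComplexPoints K))) := by
  simp [phi]

include hS hK in
/-- `Φ` is injective (`κ` is an isomorphism, `id ⊗ incl` is injective over a field). -/
theorem phi_injective : Function.Injective (phi (A := A) (K := K) (j := j) (act := act)) :=
  (kunnethCross_bijective hS hK).1.comp
    (Module.Flat.lTensor_preserves_injective_linearMap _ (fibreRange A K (kummerCover act j)).injective_subtype)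

/-- `range (id ⊗ incl_R) = H*(A) ⊗ R` (as the span of pure tensors). -/
theorem range_lTensor_subtype_eq_tensorWith (Θ : A.X ⊗ K ⟶ H) :
    LinearMap.range ((fibreRange A K Θ).subtype.lTensor (totalCohomology ℂ (ComplexPoints A.X))) =
      tensorWith (totalCohomology ℂ (ComplexPoints A.X)) (fibreRange A K Θ) := by
  rw [LinearMap.lTensor, TensorProduct.range_map_eq_span_tmul, tensorWith]
  congr 1
  ext t
  constructor
  · rintro ⟨m, s, rfl⟩
    exact ⟨m, s, s.2, rfl⟩
  · rintro ⟨m, s, hs, rfl⟩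
    exact ⟨m, ⟨s, hs⟩, rfl⟩

include hc hdeck hS hK in
/-- `range Φ = range Θ^*`. -/
theorem range_phi_eq : LinearMap.range (phi (A := A) (K := K) (j := j) (act := act)) =
    LinearMap.range (totalPullback ℂ (AlgPoints.mapContinuous (L := ℂ) (kummerCover act j))) := by
  rw [phi, LinearMap.range_comp, range_lTensor_subtype_eq_tensorWith, range_totalPullback_eq c hc hdeck hS hK]

/-- **`Ψ : H*(A) ⊗ R ≃ H*(H)`**, the composite `H*(A) ⊗ R ≅ range Φ = range Θ^* ≅ H*(H)`. -/
def psi : totalCohomology ℂ (ComplexPoints A.X) ⊗[ℂ] (fibreRange A K (kummerCover act j)) ≃ₗ[ℂ]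
    totalCohomology ℂ (ComplexPoints H) :=
  (LinearEquiv.ofInjective _ (phi_injective hS hK)).trans
    ((LinearEquiv.ofEq _ _ (range_phi_eq c hc hdeck hS hK)).trans
      (LinearEquiv.ofInjective _ (totalPullback_kummerCover_injective c hc)).symm)

/-- **`Θ^* (Ψ t) = Φ t`.** -/
theorem totalPullback_psi (t : totalCohomology ℂ (ComplexPoints A.X) ⊗[ℂ] (fibreRange A K (kummerCover act j))) :
    totalPullback ℂ (AlgPoints.mapContinuous (L := ℂ) (kummerCover act j)) (psi c hc hdeck hS hK t) = phi t := by
  rw [psi, LinearEquiv.trans_apply, LinearEquiv.trans_apply]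
  set v := (LinearEquiv.ofEq _ _ (range_phi_eq c hc hdeck hS hK))
    (LinearEquiv.ofInjective _ (phi_injective hS hK (j := j) (act := act)) t) with hv
  have h1 : ∀ u : LinearMap.range (totalPullback ℂ (AlgPoints.mapContinuous (L := ℂ) (kummerCover act j))),
      totalPullback ℂ (AlgPoints.mapContinuous (L := ℂ) (kummerCover act j))
        ((LinearEquiv.ofInjective _ (totalPullback_kummerCover_injective c hc)).symm u) = (u : _) := by
    intro u
    have h2 := LinearEquiv.ofInjective_apply (f := totalPullback ℂ (AlgPoints.mapContinuous (L := ℂ) (kummerCover act j)))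
      (h := totalPullback_kummerCover_injective c hc)
      ((LinearEquiv.ofInjective _ (totalPullback_kummerCover_injective c hc)).symm u)
    rw [LinearEquiv.apply_symm_apply] at h2
    exact h2.symm
  rw [h1, hv]
  rfl

/-- **`h_A ⊗ 1 + 1 ⊗ h_R`** on `H*(A) ⊗ R`. -/
def tensorDegreeOp : Module.End ℂ (totalCohomology ℂ (ComplexPoints A.X) ⊗[ℂ] (fibreRange A K (kummerCover act j))) :=
  (degreeOperator ℂ (ComplexPoints A.X) 2).rTensor (fibreRange A K (kummerCover act j)) +
    (fibreDegreeOp c hc hdeck hS hK hH hact).lTensor (totalCohomology ℂ (ComplexPoints A.X))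

/-- **`L_x ⊗ 1 + 1 ⊗ L_R`** on `H*(A) ⊗ R`. -/
def tensorLefschetzOp (ℓ : complexBetti H 2) (x : complexBetti A.X 2) :
    Module.End ℂ (totalCohomology ℂ (ComplexPoints A.X) ⊗[ℂ] (fibreRange A K (kummerCover act j))) :=
  (totalLefschetz x).rTensor (fibreRange A K (kummerCover act j)) +
    (fibreLefschetzOp c hc hdeck hS hK hH hact ℓ).lTensor (totalCohomology ℂ (ComplexPoints A.X))

/-- `Φ` intertwines `h_A ⊗ 1 + 1 ⊗ h_R` with `h_{A × K}` (dimension `2 + 2n`). -/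
theorem phi_tensorDegreeOp (t : totalCohomology ℂ (ComplexPoints A.X) ⊗[ℂ] (fibreRange A K (kummerCover act j))) :
    phi (tensorDegreeOp c hc hdeck hS hK hH hact t) =
      degreeOperator ℂ (ComplexPoints (A.X ⊗ K)) (2 + 2 * n) (phi t) := by
  induction t using TensorProduct.induction_on with
  | zero => simp only [map_zero]
  | add x y hx hy => simp only [map_add, hx, hy]
  | tmul a s =>
    rw [tensorDegreeOp, LinearMap.add_apply, LinearMap.rTensor_tmul, LinearMap.lTensor_tmul, map_add, phi_tmul,
      phi_tmul, phi_tmul, coe_fibreDegreeOp, degreeOperator_totalCross, LinearMap.add_apply, LinearMap.rTensor_tmul,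
      LinearMap.lTensor_tmul, map_add]

/-- `Φ` intertwines `L_x ⊗ 1 + 1 ⊗ L_R` with `L_{fst^* x + snd^* θ^*ℓ}`. -/
theorem phi_tensorLefschetzOp (ℓ : complexBetti H 2) (x : complexBetti A.X 2)
    (t : totalCohomology ℂ (ComplexPoints A.X) ⊗[ℂ] (fibreRange A K (kummerCover act j))) :
    phi (tensorLefschetzOp c hc hdeck hS hK hH hact ℓ x t) =
      totalLefschetz (complexBetti.map (fst A.X K) 2 x + complexBetti.map (snd A.X K) 2 (complexBetti.map j 2 ℓ))
        (phi t) := by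
  induction t using TensorProduct.induction_on with
  | zero => simp only [map_zero]
  | add x y hx hy => simp only [map_add, hx, hy]
  | tmul a s =>
    rw [tensorLefschetzOp, LinearMap.add_apply, LinearMap.rTensor_tmul, LinearMap.lTensor_tmul, map_add, phi_tmul,
      phi_tmul, phi_tmul, coe_fibreLefschetzOp, totalLefschetz_totalCross, LinearMap.add_apply, LinearMap.rTensor_tmul,
      LinearMap.lTensor_tmul, map_add]

/-- **`Ψ` intertwines the degree operators**: `Ψ ∘ (h_A ⊗ 1 + 1 ⊗ h_R) = h_H ∘ Ψ` (dimension of `H` = `2(n+1)`). -/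
theorem psi_tensorDegreeOp (t : totalCohomology ℂ (ComplexPoints A.X) ⊗[ℂ] (fibreRange A K (kummerCover act j))) :
    psi c hc hdeck hS hK (tensorDegreeOp c hc hdeck hS hK hH hact t) =
      degreeOperator ℂ (ComplexPoints H) (2 * (n + 1)) (psi c hc hdeck hS hK t) := by
  apply totalPullback_kummerCover_injective c hc
  rw [totalPullback_psi, phi_tensorDegreeOp, ← degreeOperator_totalPullback, totalPullback_psi,
    show 2 * (n + 1) = 2 + 2 * n by ring]

/-- **`Ψ` intertwines the Lefschetz operators**: `Ψ ∘ (L_x ⊗ 1 + 1 ⊗ L_R) = L_ℓ ∘ Ψ` when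
`Θ^* ℓ = fst^* x + snd^* θ^* ℓ`. -/
theorem psi_tensorLefschetzOp (ℓ : complexBetti H 2) {x : complexBetti A.X 2}
    (hx : complexBetti.map (kummerCover act j) 2 ℓ =
      complexBetti.map (fst A.X K) 2 x + complexBetti.map (snd A.X K) 2 (complexBetti.map j 2 ℓ))
    (t : totalCohomology ℂ (ComplexPoints A.X) ⊗[ℂ] (fibreRange A K (kummerCover act j))) :
    psi c hc hdeck hS hK (tensorLefschetzOp c hc hdeck hS hK hH hact ℓ x t) =
      totalLefschetz ℓ (psi c hc hdeck hS hK t) := by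
  apply totalPullback_kummerCover_injective c hc
  rw [totalPullback_psi, phi_tensorLefschetzOp, ← hx, ← totalLefschetz_totalPullback, totalPullback_psi]

include hH hact in
/-- **`L_x ⊗ 1 + 1 ⊗ L_R` has the Lefschetz property on `(H*(A) ⊗ R, h_A ⊗ 1 + 1 ⊗ h_R)`** — transported from
`(H*(H), h_H, L_ℓ, Λ_H)` along `Ψ`. -/
theorem hasLefschetzProperty_tensor_fibreRange (ℓ : complexBetti H 2) {x : complexBetti A.X 2}
    (hx : complexBetti.map (kummerCover act j) 2 ℓ =
      complexBetti.map (fst A.X K) 2 x + complexBetti.map (snd A.X K) 2 (complexBetti.map j 2 ℓ))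
    {Λ_H : Module.End ℂ (totalCohomology ℂ (ComplexPoints H))} (hΛH : IsDualLefschetz (2 * (n + 1)) ℓ Λ_H) :
    HasLefschetzProperty (tensorDegreeOp c hc hdeck hS hK hH hact) (tensorLefschetzOp c hc hdeck hS hK hH hact ℓ x) := by
  haveI := finite_totalCohomology hS
  haveI := finite_totalCohomology hK
  set Ψ := psi c hc hdeck hS hK with hΨ
  -- the transported triple
  have t' := isSl2Triple_conj Ψ.symm hΛH
  have h1 : Ψ.symm.conj (degreeOperator ℂ (ComplexPoints H) (2 * (n + 1))) = tensorDegreeOp c hc hdeck hS hK hH hact := by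
    refine LinearMap.ext fun t ↦ ?_
    rw [LinearEquiv.conj_apply_apply, LinearEquiv.symm_symm, LinearEquiv.symm_apply_eq, hΨ, psi_tensorDegreeOp]
  have h2 : Ψ.symm.conj (totalLefschetz ℓ) = tensorLefschetzOp c hc hdeck hS hK hH hact ℓ x := by
    refine LinearMap.ext fun t ↦ ?_
    rw [LinearEquiv.conj_apply_apply, LinearEquiv.symm_symm, LinearEquiv.symm_apply_eq, hΨ,
      psi_tensorLefschetzOp c hc hdeck hS hK hH hact ℓ hx]
  rw [h1, h2] at t'
  exact Literature.Algebra.Lie.hasLefschetzProperty_of_isSl2Triple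
    (Literature.Algebra.Lie.isZGrading_rTensor_add_lTensor (isZGrading_degreeOperator 2)
      (isZGrading_fibreRange c hc hdeck hS hK hH hact)) t'

end Main

end Summit.Ventures.HodgeKum4.HilbertKummer

end
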